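import Summits.HubbardSuperconductivity.HubbardSuperconductivity.Theorems.AnisotropyChordStiffnessFarFieldLR
import Summits.HubbardSuperconductivity.HubbardSuperconductivity.Theorems.AnisotropyChordStiffnessLocalitySkeleton

/-!
# Route `AnisotropyChord` / H0 rotor rung: S_max FROM COMPRESSIBILITY (K) and the f-sum rule, and the END-TO-END THEOREM
# «(S_Υ) + (K) + (H1′) ⇒ BEC» (theory seat memo ROTOR-THEORY-8 §124 (e)/§125; Sketch8 Part AH ported)

`P·S(k) ≤ √(m₁(k) m₋₁(k))` with `m₁ ≤ 2L²` (lattice f-sum rule) and `m₋₁ ≤ κL²` ((K) `UniformSusceptibility`), `P ≥ (ρ/2)L²`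
on the density window: **`structureFactorUpper_of_susceptibility`**; then **`eventualCondensate_of_stiffness_compressibility`**
composes it with `eventualCondensate_of_farFieldKernelDecay` and `farFieldKernelDecay_holds`.
Typing/proof authority for the port: theory seat `hubbard-h0-rotor-theory-1`, cycle 8.
-/

set_option linter.dupNamespace false

noncomputable section

open Matrix Complex Finset Filter Topology
open scoped ComplexConjugate Matrix.Norms.L2Operator
open Literature.MathematicalPhysics.QuantumLattice hiding torusPhase torusNorm
open Literature.Probability.LatticeModels
open Summit.HubbardSuperconductivity.HubbardSuperconductivity.Theorems.AnisotropyChord.InsertionEntropy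

namespace Summit.HubbardSuperconductivity.HubbardSuperconductivity.Theorems.AnisotropyChord.Stiffness

section HelpersA
variable (L : ℕ) [NeZero L]

/-- `‖ρ_k a‖² = P · S_a(k)` (the tree's `structureFactor` divides by the particle number `P`). -/
theorem normSq_densityMode_mulVec (a : TensorIndex (TorusSite 2 L) 2 → ℝ) (P : ℝ) (hP : P ≠ 0)
    (k : TorusSite 2 L) :
    ∑ σ, ‖(densityModeOp L k *ᵥ toC L a) σ‖ ^ 2 = P * structureFactor L a P k := by
  unfold structureFactor densityModeOp toC
  rw [mul_div_cancel₀ _ hP]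
  refine Finset.sum_congr rfl fun σ _ => ?_
  rw [mulVec_diagonal, norm_mul, mul_pow, Complex.norm_real, Real.norm_eq_abs, sq_abs, mul_comm]

/-- On an eigenvector `a` of `H` with eigenvalue `E`:  `D_k a = H (ρ_k a) − E (ρ_k a)`. -/
theorem currentDiv_mulVec_eigen (Δ : ℝ) (a : TensorIndex (TorusSite 2 L) 2 → ℝ) (E : ℝ)
    (ha : hcbHamiltonian L Δ *ᵥ toC L a = (E : ℂ) • toC L a) (k : TorusSite 2 L) :
    currentDiv L Δ k *ᵥ toC L a
      = hcbHamiltonian L Δ *ᵥ (densityModeOp L k *ᵥ toC L a) - (E : ℂ) • (densityModeOp L k *ᵥ toC L a) := by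
  unfold currentDiv
  rw [sub_mulVec, ← mulVec_mulVec, ← mulVec_mulVec, ha, mulVec_smul]

end HelpersA

/-- Quadratic forms are bounded by the operator norm on unit vectors. -/
theorem re_quadForm_le_norm {m : Type*} [Fintype m] [DecidableEq m] (M : Matrix m m ℂ) (u : m → ℂ)
    (hu : ‖(WithLp.toLp 2 u : EuclideanSpace ℂ m)‖ = 1) :
    (star u ⬝ᵥ (M *ᵥ u)).re ≤ ‖M‖ := by
  have h1 : star u ⬝ᵥ (M *ᵥ u)
      = inner ℂ (WithLp.toLp 2 u : EuclideanSpace ℂ m) (WithLp.toLp 2 (M *ᵥ u)) := by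
    rw [EuclideanSpace.inner_toLp_toLp, dotProduct_comm]
  have h2 : ‖(WithLp.toLp 2 (M *ᵥ u) : EuclideanSpace ℂ m)‖
      ≤ ‖M‖ * ‖(WithLp.toLp 2 u : EuclideanSpace ℂ m)‖ :=
    Matrix.l2_opNorm_mulVec M (WithLp.toLp 2 u)
  rw [hu, mul_one] at h2
  calc (star u ⬝ᵥ (M *ᵥ u)).re ≤ ‖star u ⬝ᵥ (M *ᵥ u)‖ := Complex.re_le_norm _
    _ = ‖inner ℂ (WithLp.toLp 2 u : EuclideanSpace ℂ m) (WithLp.toLp 2 (M *ᵥ u))‖ := by rw [h1]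
    _ ≤ ‖(WithLp.toLp 2 u : EuclideanSpace ℂ m)‖ * ‖(WithLp.toLp 2 (M *ᵥ u) : EuclideanSpace ℂ m)‖ :=
        norm_inner_le_norm _ _
    _ ≤ 1 * ‖M‖ := by rw [hu]; exact mul_le_mul_of_nonneg_left h2 zero_le_one
    _ = ‖M‖ := one_mul _

/-- Expansion of a vector in the orthonormal eigenbasis (dot-product form). -/
theorem onb_expand {n : Type*} [Fintype n] [DecidableEq n] {H : Matrix n n ℂ}
    (hH : H.IsHermitian) (w : n → ℂ) :
    w = ∑ j, (star ⇑(hH.eigenvectorBasis j) ⬝ᵥ w) • ⇑(hH.eigenvectorBasis j) := by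
  have hw : w = (hH.eigenvectorUnitary : Matrix n n ℂ) *ᵥ
      (star (hH.eigenvectorUnitary : Matrix n n ℂ) *ᵥ w) := by
    rw [Matrix.mulVec_mulVec, Unitary.mul_star_self_of_mem hH.eigenvectorUnitary.2, Matrix.one_mulVec]
  conv_lhs => rw [hw]
  funext k
  simp only [Matrix.mulVec, dotProduct, Finset.sum_apply, Pi.smul_apply, smul_eq_mul,
    Matrix.IsHermitian.eigenvectorUnitary_apply, Matrix.star_eq_conjTranspose,
    Matrix.conjTranspose_apply, Pi.star_apply]
  refine Finset.sum_congr rfl fun j _ => ?_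
  ring

/-- The amplitude `⟨vᵢ, ρ_k ψ⟩` of the density mode on the eigenvector `vᵢ`. -/
def densityAmp (L : ℕ) [NeZero L] (Δ : ℝ) (a : TensorIndex (TorusSite 2 L) 2 → ℝ) (k : TorusSite 2 L)
    (i : TensorIndex (TorusSite 2 L) 2) : ℂ :=
  star (⇑((hcbHamiltonian_isHermitian L Δ).eigenvectorBasis i)) ⬝ᵥ (densityModeOp L k *ᵥ toC L a)

/-- **HYPOTHESIS (K) — `UniformSusceptibility`** (bounded compressibility = bounded static density response at
every `k ≠ 0`, finite-volume spectral form; memo ROTOR-THEORY-8 §124 (e)).  Eventually in `L`, for the Perron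
amplitudes of both sectors `M_L`, `M_L − 1` and every `k ≠ 0`:  (i) `ρ_kψ` has no weight on eigenvectors at or
below the sector ground energy (for `ωᵢ < 0` this is `sectorVanishing`; for `ωᵢ = 0` it is Perron uniqueness +
translation invariance, `⟨ψ, ρ_kψ⟩ = 0`) and (ii) `χ_L(k)·|Λ|/2 = Σ_{ωᵢ>0} |⟨vᵢ,ρ_kψ⟩|²/ωᵢ ≤ κ L²`.
With Lean's `x/0 = 0`, clause (i) is exactly what keeps (ii) honest.  This is hypothesis (K) of H0 (a physical
hypothesis, not a lattice identity; typing authority theory seat hubbard-h0-rotor-theory-1, cycle 8, memo §124 (e)). -/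
def UniformSusceptibility (Δ : ℝ) (M : ℕ → ℝ) : Prop :=
  ∃ κ : ℝ, ∀ᶠ L : ℕ in atTop, ∀ [NeZero L],
    ∀ a : TensorIndex (TorusSite 2 L) 2 → ℝ, ∀ M' ∈ ({M L, M L - 1} : Set ℝ),
      IsPerronSectorGroundAmplitude L Δ M' a → ∀ k : TorusSite 2 L, k ≠ 0 →
        (∀ i, excitation L Δ M' i ≤ 0 → densityAmp L Δ a k i = 0) ∧
        ∑ i, ‖densityAmp L Δ a k i‖ ^ 2 / excitation L Δ M' i ≤ κ * (L : ℝ) ^ 2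

/-- Parseval in the eigenbasis, dot-product form: `Σᵢ |⟨vᵢ,w⟩|² = ‖w‖²`. [folklore] -/
theorem sum_norm_sq_eigen_dotProduct {n : Type*} [Fintype n] [DecidableEq n] {H : Matrix n n ℂ}
    (hH : H.IsHermitian) (w : n → ℂ) :
    ∑ i, ‖star ⇑(hH.eigenvectorBasis i) ⬝ᵥ w‖ ^ 2 = ∑ σ, ‖w σ‖ ^ 2 := by
  have hexp := onb_expand hH w
  have hA : star w ⬝ᵥ w = ((∑ σ, ‖w σ‖ ^ 2 : ℝ) : ℂ) := by
    push_cast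
    simp only [dotProduct, Pi.star_apply, Complex.star_def, Complex.conj_mul']
  have hB : star w ⬝ᵥ (∑ i, (star ⇑(hH.eigenvectorBasis i) ⬝ᵥ w) • ⇑(hH.eigenvectorBasis i))
      = ((∑ i, ‖star ⇑(hH.eigenvectorBasis i) ⬝ᵥ w‖ ^ 2 : ℝ) : ℂ) := by
    rw [dotProduct_sum]
    push_cast
    refine Finset.sum_congr rfl fun i _ => ?_
    rw [dotProduct_smul, smul_eq_mul, Matrix.star_dotProduct w, Complex.star_def, Complex.mul_conj,
      Complex.normSq_eq_norm_sq]
    push_cast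
    rfl
  rw [← hexp, hA] at hB
  exact_mod_cast hB.symm

/-- `|⟨vᵢ, D_kψ⟩|² = ωᵢ² |⟨vᵢ, ρ_kψ⟩|²` for a sector ground amplitude (`D_kψ = (H − E₀)ρ_kψ`). [folklore] -/
theorem currentSpecWeight_eq_sq (L : ℕ) [NeZero L] (Δ M : ℝ) (a : TensorIndex (TorusSite 2 L) 2 → ℝ)
    (ha : IsPerronSectorGroundAmplitude L Δ M a) (k : TorusSite 2 L) (i : TensorIndex (TorusSite 2 L) 2) :
    currentSpecWeight L Δ a k i = excitation L Δ M i ^ 2 * ‖densityAmp L Δ a k i‖ ^ 2 := by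
  unfold currentSpecWeight densityAmp excitation
  rw [currentDiv_mulVec_eigen L Δ a _ ha.eigen k]
  have hH := hcbHamiltonian_isHermitian L Δ
  have heig : hcbHamiltonian L Δ *ᵥ ⇑((hcbHamiltonian_isHermitian L Δ).eigenvectorBasis i)
      = (((hcbHamiltonian_isHermitian L Δ).eigenvalues i : ℝ) : ℂ)
          • ⇑((hcbHamiltonian_isHermitian L Δ).eigenvectorBasis i) := by
    rw [(hcbHamiltonian_isHermitian L Δ).mulVec_eigenvectorBasis i]
    funext σ
    simp only [Pi.smul_apply, Complex.real_smul, smul_eq_mul]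
  have key : ∀ (x : TensorIndex (TorusSite 2 L) 2 → ℂ) (E : ℝ),
      star ⇑((hcbHamiltonian_isHermitian L Δ).eigenvectorBasis i) ⬝ᵥ (hcbHamiltonian L Δ *ᵥ x - (E : ℂ) • x)
        = (((hcbHamiltonian_isHermitian L Δ).eigenvalues i - E : ℝ) : ℂ)
            * (star ⇑((hcbHamiltonian_isHermitian L Δ).eigenvectorBasis i) ⬝ᵥ x) := by
    intro x E
    have h1 : star ⇑((hcbHamiltonian_isHermitian L Δ).eigenvectorBasis i) ⬝ᵥ (hcbHamiltonian L Δ *ᵥ x)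
        = (((hcbHamiltonian_isHermitian L Δ).eigenvalues i : ℝ) : ℂ)
            * (star ⇑((hcbHamiltonian_isHermitian L Δ).eigenvectorBasis i) ⬝ᵥ x) := by
      rw [dotProduct_mulVec]
      have : star ⇑((hcbHamiltonian_isHermitian L Δ).eigenvectorBasis i) ᵥ* hcbHamiltonian L Δ
          = (((hcbHamiltonian_isHermitian L Δ).eigenvalues i : ℝ) : ℂ)
              • star ⇑((hcbHamiltonian_isHermitian L Δ).eigenvectorBasis i) := by
        have h2 : star (hcbHamiltonian L Δ *ᵥ ⇑((hcbHamiltonian_isHermitian L Δ).eigenvectorBasis i))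
            = star ⇑((hcbHamiltonian_isHermitian L Δ).eigenvectorBasis i) ᵥ* hcbHamiltonian L Δ := by
          rw [star_mulVec, hH.eq]
        rw [← h2, heig, star_smul]
        simp
      rw [this, smul_dotProduct, smul_eq_mul]
    rw [dotProduct_sub, dotProduct_smul, h1, smul_eq_mul]
    push_cast
    ring
  rw [key, norm_mul, mul_pow, Complex.norm_real, Real.norm_eq_abs, sq_abs]

/-- `⟨−T_j⟩ ≤ L²/2` (the kinetic operator has norm `≤ L²/2`). [folklore] -/
theorem kineticExpect_le (L : ℕ) [NeZero L] {Δ M : ℝ} {a : TensorIndex (TorusSite 2 L) 2 → ℝ}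
    (ha : IsPerronSectorGroundAmplitude L Δ M a) (j : Fin 2) :
    kineticExpect L a j ≤ (L : ℝ) ^ 2 / 2 := by
  have hT : ‖kineticOp L j‖ ≤ (L : ℝ) ^ 2 / 2 := by
    unfold kineticOp
    calc ‖∑ x : TorusSite 2 L, (spinBond 1 0 x (x + Pi.single j 1) + spinBond 1 1 x (x + Pi.single j 1) :
            Op (TorusSite 2 L) 2)‖
        ≤ ∑ x : TorusSite 2 L, ‖(spinBond 1 0 x (x + Pi.single j 1) + spinBond 1 1 x (x + Pi.single j 1) :
            Op (TorusSite 2 L) 2)‖ := norm_sum_le _ _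
      _ ≤ ∑ x : TorusSite 2 L, (1 / 2 : ℝ) := by
          refine Finset.sum_le_sum fun x _ => (norm_add_le _ _).trans ?_
          have h0 := norm_spinBond_le L 0 x (x + Pi.single j 1)
          have h1 := norm_spinBond_le L 1 x (x + Pi.single j 1)
          linarith
      _ = (L : ℝ) ^ 2 / 2 := by
          rw [Finset.sum_const, Finset.card_univ, show Fintype.card (TorusSite 2 L) = L ^ 2 by simp [Fintype.card_pi, ZMod.card], nsmul_eq_mul]
          push_cast
          ring
  unfold kineticExpect
  exact (re_quadForm_le_norm _ _ (norm_toC_eq_one L ha)).trans hT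

/-- `0 ≤ 1 − cos(2πk_j/L)`: the f-sum weight is non-negative. -/
theorem fsumWeight_nonneg (L : ℕ) [NeZero L] (k : TorusSite 2 L) (j : Fin 2) : 0 ≤ fsumWeight L k j := by
  unfold fsumWeight
  linarith [Real.cos_le_one (2 * Real.pi * ((k j).val : ℝ) / (L : ℝ))]

/-- `1 − cos(2πk_j/L) ≤ 2`. -/
theorem fsumWeight_le_two (L : ℕ) [NeZero L] (k : TorusSite 2 L) (j : Fin 2) : fsumWeight L k j ≤ 2 := by
  unfold fsumWeight
  linarith [Real.neg_one_le_cos (2 * Real.pi * ((k j).val : ℝ) / (L : ℝ))]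

/-- The spectral Cauchy–Schwarz step `(Σ cᵢ²)² ≤ (Σ ωᵢcᵢ²)(Σ cᵢ²/ωᵢ)` when no weight sits at `ωᵢ ≤ 0`
(with the two moment sums non-negative). [folklore] -/
theorem cs_spectral {ι : Type*} [Fintype ι] (c ω : ι → ℝ) (hzero : ∀ i, ω i ≤ 0 → c i = 0) :
    (∑ i, c i ^ 2) ^ 2 ≤ (∑ i, ω i * c i ^ 2) * (∑ i, c i ^ 2 / ω i)
      ∧ 0 ≤ ∑ i, ω i * c i ^ 2 ∧ 0 ≤ ∑ i, c i ^ 2 / ω i := by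
  have hfg : ∀ i, (Real.sqrt (ω i) * c i) * (c i / Real.sqrt (ω i)) = c i ^ 2 := by
    intro i
    by_cases h : 0 < ω i
    · have hs : 0 < Real.sqrt (ω i) := Real.sqrt_pos.mpr h
      field_simp
    · simp [hzero i (not_lt.mp h)]
  have hf2 : ∀ i, (Real.sqrt (ω i) * c i) ^ 2 = ω i * c i ^ 2 := by
    intro i
    by_cases h : 0 < ω i
    · rw [mul_pow, Real.sq_sqrt h.le]
    · simp [hzero i (not_lt.mp h)]
  have hg2 : ∀ i, (c i / Real.sqrt (ω i)) ^ 2 = c i ^ 2 / ω i := by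
    intro i
    by_cases h : 0 < ω i
    · rw [div_pow, Real.sq_sqrt h.le]
    · simp [hzero i (not_lt.mp h)]
  have hcs := Finset.sum_mul_sq_le_sq_mul_sq Finset.univ (fun i => Real.sqrt (ω i) * c i)
    (fun i => c i / Real.sqrt (ω i))
  simp only [hfg, hf2, hg2] at hcs
  refine ⟨hcs, ?_, ?_⟩
  · rw [show (∑ i, ω i * c i ^ 2) = ∑ i, (Real.sqrt (ω i) * c i) ^ 2 from
      Finset.sum_congr rfl fun i _ => (hf2 i).symm]
    exact Finset.sum_nonneg fun i _ => sq_nonneg _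
  · rw [show (∑ i, c i ^ 2 / ω i) = ∑ i, (c i / Real.sqrt (ω i)) ^ 2 from
      Finset.sum_congr rfl fun i _ => (hg2 i).symm]
    exact Finset.sum_nonneg fun i _ => sq_nonneg _

/-- **S_max FROM (K) + f-SUM (PROVED; memo §124 (e)).**  `(P·S(k))² = (Σᵢ|cᵢ|²)² ≤ m₁(k)·m₋₁(k) ≤ 2L²·κL²`
with `m₁(k) = Σ_j (1 − cos k_j)⟨−T_j⟩ ≤ 2L²` (lattice f-sum rule, `⟨−T_j⟩ ≤ L²/2`) and `m₋₁ ≤ κL²` ((K)),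
and `P ≥ (ρ/2)L²` on the density window: `S(k) ≤ 2√(2κ⁺)/ρ`. [folklore] -/
theorem structureFactorUpper_of_susceptibility (Δ : ℝ) (M : ℕ → ℝ) (ρ : ℝ) (hρ : ρ ∈ Set.Ioo (0 : ℝ) 1)
    (hlim : Tendsto (fun L : ℕ => 1 / 2 + M L / (L : ℝ) ^ 2) atTop (nhds ρ))
    (hF : LatticeFSumRule Δ) (hK : UniformSusceptibility Δ M) : StructureFactorUpper Δ M := by
  obtain ⟨κ, hκ⟩ := hK
  have hρ0 : 0 < ρ := hρ.1
  have hκ' : 0 ≤ 2 * max κ 0 := by positivity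
  refine ⟨2 * Real.sqrt (2 * max κ 0) / ρ, ?_⟩
  have hMlo : ∀ᶠ L : ℕ in atTop, ρ / 2 ≤ 1 / 2 + (M L - 1) / (L : ℝ) ^ 2 :=
    (tendsto_density_pred M ρ hlim).eventually (eventually_ge_nhds (by linarith))
  filter_upwards [hκ, hMlo, eventually_ge_atTop 3] with L hKL hlo h3
  intro _ a M' hM' ha k hk
  have hL0 : (0 : ℝ) < (L : ℝ) := by exact_mod_cast Nat.pos_of_ne_zero (NeZero.ne L)
  have hL2 : (0 : ℝ) < (L : ℝ) ^ 2 := by positivity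
  have hM'ge : M L - 1 ≤ M' := by
    simp only [Set.mem_insert_iff, Set.mem_singleton_iff] at hM'
    rcases hM' with h | h
    · rw [h]; linarith
    · rw [h]
  have hPlo : ρ / 2 * (L : ℝ) ^ 2 ≤ (L : ℝ) ^ 2 / 2 + M' := by
    have h := mul_le_mul_of_nonneg_right hlo hL2.le
    rw [add_mul, div_mul_cancel₀ _ hL2.ne'] at h
    linarith
  have hP0 : 0 < (L : ℝ) ^ 2 / 2 + M' := lt_of_lt_of_le (by positivity) hPlo
  obtain ⟨hzero, hm⟩ := hKL a M' hM' ha k hk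
  -- Parseval: X = P·S
  have hX : ∑ i, ‖densityAmp L Δ a k i‖ ^ 2 = ((L : ℝ) ^ 2 / 2 + M') * structureFactor L a ((L : ℝ) ^ 2 / 2 + M') k := by
    unfold densityAmp
    rw [sum_norm_sq_eigen_dotProduct, normSq_densityMode_mulVec L a _ hP0.ne' k]
  -- m₁ = f-sum ≤ 2L²
  have hFL := hF L h3 M' a ha k
  have hdiv : ∀ i, currentSpecWeight L Δ a k i / excitation L Δ M' i
      = excitation L Δ M' i * ‖densityAmp L Δ a k i‖ ^ 2 := by
    intro i
    rw [currentSpecWeight_eq_sq L Δ M' a ha k i]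
    rcases eq_or_ne (excitation L Δ M' i) 0 with h0 | h0
    · simp [h0]
    · rw [div_eq_iff h0]
      ring
  have hm1 : ∑ i, excitation L Δ M' i * ‖densityAmp L Δ a k i‖ ^ 2 ≤ 2 * (L : ℝ) ^ 2 := by
    rw [show (∑ i, excitation L Δ M' i * ‖densityAmp L Δ a k i‖ ^ 2)
        = ∑ j : Fin 2, fsumWeight L k j * kineticExpect L a j from by
          rw [← hFL]; exact Finset.sum_congr rfl fun i _ => (hdiv i).symm]
    calc ∑ j : Fin 2, fsumWeight L k j * kineticExpect L a j ≤ ∑ j : Fin 2, (L : ℝ) ^ 2 := by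
          refine Finset.sum_le_sum fun j _ => ?_
          have hfw0 := fsumWeight_nonneg L k j
          have hfw2 := fsumWeight_le_two L k j
          have hke := kineticExpect_le L ha j
          nlinarith [mul_le_mul_of_nonneg_left hke hfw0]
      _ = 2 * (L : ℝ) ^ 2 := by
          rw [Finset.sum_const, Finset.card_univ, Fintype.card_fin, nsmul_eq_mul, Nat.cast_ofNat]
  -- m₋₁ ≤ κ⁺ L²
  have hm_1 : ∑ i, ‖densityAmp L Δ a k i‖ ^ 2 / excitation L Δ M' i ≤ max κ 0 * (L : ℝ) ^ 2 :=
    hm.trans (mul_le_mul_of_nonneg_right (le_max_left κ 0) hL2.le)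
  -- Cauchy–Schwarz
  obtain ⟨hcs, hm1nn, hm_1nn⟩ := cs_spectral (fun i => ‖densityAmp L Δ a k i‖) (fun i => excitation L Δ M' i)
    (fun i hi => by rw [hzero i hi, norm_zero])
  have hX2 : (∑ i, ‖densityAmp L Δ a k i‖ ^ 2) ^ 2 ≤ (2 * (L : ℝ) ^ 2) * (max κ 0 * (L : ℝ) ^ 2) :=
    hcs.trans (mul_le_mul hm1 hm_1 hm_1nn (by positivity))
  have hB2 : (Real.sqrt (2 * max κ 0) * (L : ℝ) ^ 2) ^ 2 = (2 * (L : ℝ) ^ 2) * (max κ 0 * (L : ℝ) ^ 2) := by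
    rw [mul_pow, Real.sq_sqrt hκ']
    ring
  have hXB : ∑ i, ‖densityAmp L Δ a k i‖ ^ 2 ≤ Real.sqrt (2 * max κ 0) * (L : ℝ) ^ 2 := by
    have h := Real.sqrt_le_sqrt (hX2.trans hB2.symm.le)
    rwa [Real.sqrt_sq (Finset.sum_nonneg fun i _ => sq_nonneg _), Real.sqrt_sq (by positivity)] at h
  -- conclusion
  have h5 : Real.sqrt (2 * max κ 0) * (L : ℝ) ^ 2
      ≤ ((L : ℝ) ^ 2 / 2 + M') * (2 * Real.sqrt (2 * max κ 0) / ρ) := by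
    rw [mul_div_assoc', le_div_iff₀ hρ0]
    nlinarith [mul_le_mul_of_nonneg_left hPlo (Real.sqrt_nonneg (2 * max κ 0))]
  have h6 : ((L : ℝ) ^ 2 / 2 + M') * structureFactor L a ((L : ℝ) ^ 2 / 2 + M') k
      ≤ ((L : ℝ) ^ 2 / 2 + M') * (2 * Real.sqrt (2 * max κ 0) / ρ) := by
    rw [← hX]
    exact hXB.trans h5
  exact le_of_mul_le_mul_left h6 hP0


/-- **THE H0 ROTOR RUNG, END TO END (skeleton v11 of this file family = theory seat v18): «uniform twist stiffness (S_Υ)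
+ bounded compressibility (K) + infrared Gaussianity of the insertion law (H1′) ⇒ Bose–Einstein condensation» for the
half-filled-window hard-core Bose gas on `(ℤ/L)²`, `T = 0`.**  Every analytic input — the f-sum rule, the continuity
equation, the Lieb–Robinson far field K2, the double-commutator bound K1′, the kernel symmetry K3, the torus geometry
G2–G5, the scale bookkeeping D5, the entropy-route reduction and S_max ⟸ (K) — is a tree theorem; the three remaining
hypotheses are the physical content of H0. -/
theorem eventualCondensate_of_stiffness_compressibility (Δ : ℝ) (M : ℕ → ℝ) (ρ : ℝ)
    (hρ : ρ ∈ Set.Ioo (0 : ℝ) 1)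
    (hlim : Tendsto (fun L : ℕ => 1 / 2 + M L / (L : ℝ) ^ 2) atTop (nhds ρ))
    (hsect : ∀ᶠ L : ℕ in atTop, ∀ [NeZero L], spinZSector (Λ := TorusSite 2 L) 1 (M L - 1) ≠ ⊥)
    (hU : UniformHelicityTensor Δ M) (hK : UniformSusceptibility Δ M)
    (hG : GaussianInsertionComparison Δ M) : EventualCondensate Δ M :=
  eventualCondensate_of_farFieldKernelDecay Δ M ρ hρ hlim hsect (farFieldKernelDecay_holds Δ M) hG hU
    (structureFactorUpper_of_susceptibility Δ M ρ hρ hlim (latticeFSumRule_holds Δ) hK)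

end Summit.HubbardSuperconductivity.HubbardSuperconductivity.Theorems.AnisotropyChord.Stiffness
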